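import Summits.ValiantsHypothesis.ValiantsHypothesis.Theorems.NNDivisionHard.Negative.RealLambdaLower
import Literature.Combinatorics.Optimization.SymmetricLpVersusSheraliAdams

/-!
# Real-λ blindness of the located permutahedron pencil, part 5 (§7): ★★★ THEOREM T4 — ROW-SYMMETRIC certificates: symmetric `rank₊ M_λ = n^{Θ(min(n, 1/λ))}`, visible iff `λ → 0` (no window)

PORT NOTE (staged by the AUTHOR val-idea-39 g5 for the Negative-lane port pool; critic of record val-idea-crit-9 g3): texts VERBATIM BY NAME from the crux
workfile `Cruxes/NNDivisionHard/RealLambda39.lean` rev 6 @bd25df79f90f §7 (sha16 7f279fd523d61682; farm rc 0 / 0 sorries / 0 warnings; axioms of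
`pencil_symm_lower` = [propext, Classical.choice, Quot.sound]), memo `Cruxes/NNDivisionHard/RealLambda39.md` rev 5 @04ec49c5b2f4 §2¾.  Deltas vs the workfile:
namespace `…Theorems.NNDivisionHardNegative.RealLambda` (sibling of `…WeakReliefBlind`), this header; part 5 of the split (§1–§2 / §3+§5 / §4 / §6 / §7); imports
part 3 (for `cutCol`, `slice_cone_lower_quarter`; transitively parts 1–2: `cj`, `InCone`, `Slot`, `LiveSlot`, `pencil`, `col_cert`) and the tree's PROVED
Chan–Lee–Raghavendra–Steurer §4 file.  CENSUS / CALIBRATION theorems about certificate families for ONE explicit matrix family; no item closes; VP ≠ VNP is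
NOT proved; the crux `NNDivisionHard` (stmt-ValiantsHypothesis-21181) stays OPEN; nothing here bears on its status.

A nonnegative factorisation `M_λ[a;(b,π)] = Σ_s U_s(a)·V_s(b,π)` is ROW-SYMMETRIC (`RowSymmetric U`) if every `σ ∈ S_n` acting on the rows is compensated by a
permutation `τ_σ` of the slots, `U_{τ_σ s}(σa) = U_s(a)` — the row half of Yannakakis' symmetric extended formulations.  UPPER (`pencil_symm_upper`): the
degree-`2T` conjunction certificate of part 2 (`λT ≥ 2`, `≤ (n+1)^{4T+1}` live slots) is row-symmetric (`S_n` permutes the slots `(k,S,T′) ↦ (k,σS,σT′)`,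
`slotPerm` / `liveSlotPerm`, `cj_map`, `rowSlot_factor`).  LOWER (`pencil_symm_lower`): if `n > 8`, `D ≥ 1`, `4(D+1) ≤ n`, `0 ≤ λ < 1/(4D)`, a row-symmetric
factorisation has `≥ C(n, D+1)` slots — with fewer, the Chan–Lee–Raghavendra–Steurer Lemma 4.2 (Yannakakis / Dixon–Mortimer 5.2B, PROVED in the tree:
`Literature.Combinatorics.Optimization.ChanEtAl2016_lemma42`), transported from `{0,1}ⁿ` to `Finset (Fin n)` (`rowSymmetric_junta`), makes each `U_s` a
function of `(a ∩ X_s, |a|)` with `|X_s| ≤ D`; on the `2D`-slice `U_s = Σ_{W ⊆ X_s} U_s(a_W)·cj(W, X_s∖W)` (`cj_inter_eq`), so every column lies in `cone_D`,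
contradicting part 3's `slice_cone_lower_quarter` (T2).  Reading: the least size of a row-symmetric nonnegative factorisation of `M_λ^{(n)}` is
`n^{Θ(min(n, 1/λ))}` — superpolynomial IFF `λ → 0`; the S2 window `[c/log² n, o(1)]` of part 4 concerns ASYMMETRIC slots only (a located
Kothari–Meka–Raghavendra-type lifting theorem is what it asks for).
[cite: ChanEtAl2016, Lemma 4.2 (arXiv:1309.0563v3 p. 12)]
-/

-- the mandated summit-side namespace repeats a component by design (single-problem summit)
set_option linter.dupNamespace false

namespace Summit.ValiantsHypothesis.Theorems.NNDivisionHardNegative.RealLambda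

open Finset
open Summit.ValiantsHypothesis.Theorems.NNDivisionHardNegative.WeakReliefBlind (inv)

noncomputable section

variable {n : ℕ}

/-! ## §7 THEOREM T4 (kernel): for ROW-SYMMETRIC certificates the window is CLOSED — symmetric `rank₊ M_λ = n^{Θ(1/λ)}` (memo T4)

A nonnegative factorisation `M_λ[a;(b,π)] = Σ_s U_s(a)·V_s(b,π)` is ROW-SYMMETRIC if every `σ ∈ S_n` acting on the rows (`a ↦ σ(a)`) is
compensated by a permutation `τ_σ` of the slots, `U_{τ_σ s}(σ a) = U_s(a)` (Yannakakis' symmetric extended formulations, read on the row factor;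
only the row half of the symmetry is used).  The conjunction certificate of T1 is row-symmetric (`pencil_symm_upper`: `S_n` permutes the slots
`(k, S, T′) ↦ (k, σS, σT′)`).  Conversely, if a row-symmetric factorisation has FEWER than `C(n, D+1)` slots (`n > 8`, `4(D+1) ≤ n`), the
Chan–Lee–Raghavendra–Steurer Lemma 4.2 (= Yannakakis' Lemma / Dixon–Mortimer Thm 5.2B, PROVED in the tree:
`Literature.Combinatorics.Optimization.ChanEtAl2016_lemma42` over `Literature.GroupTheory.PermutationGroups.alternating_fixing_le_of_index_lt_choose`)
makes every row function `U_s` depend only on `a ∩ X_s` and `|a|` for some `|X_s| ≤ D` (`rowSymmetric_junta`); on a size class it is then a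
nonnegative combination of the atoms `[a ∩ X_s = W] = cj W (X_s ∖ W)` of degree `|X_s| ≤ D` (`cj_inter_eq`), so every column of `M_λ` restricted to
the `2D`-slice lies in `cone_D` — which T2 (`slice_cone_lower_quarter`) forbids when `λ < 1/(4D)`.  Hence (`pencil_symm_lower`): below `λ = 1/(4D)`
a row-symmetric certificate needs `≥ C(n, D+1)` slots, i.e. symmetric `rank₊ M_λ ≥ C(n, min(⌊n/4⌋, ⌈1/(4λ)⌉)) = n^{Ω(min(n, 1/λ))}`, matching T1's
row-symmetric `(n+1)^{4⌈2/λ⌉+1}`: FOR SYMMETRIC CERTIFICATES `Q^Π_λ` IS VISIBLE IFF `λ → 0` (no window); the residual S2 window `[c/log² n, o(1)]`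
of §6 concerns ASYMMETRIC slots only.  [cite: ChanEtAl2016, Lemma 4.2 (arXiv:1309.0563v3 p. 12); Yannakakis1991, symmetric case] -/

section Symmetric

/-- ROW-SYMMETRIC slot families: every `σ ∈ S_n` acting on the rows is compensated by a permutation of the slots. -/
def RowSymmetric {S : Type*} (U : Finset (Fin n) → S → ℝ) : Prop :=
  ∀ σ : Equiv.Perm (Fin n), ∃ τ : Equiv.Perm S,
    ∀ (a : Finset (Fin n)) (s : S), U (a.map σ.toEmbedding) (τ s) = U a s

/-! ### T4, upper half: the conjunction certificate of T1 is row-symmetric -/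

/-- `S_n` acts on the slots: `(k, S, T′) ↦ (k, σS, σT′)` -/
def slotPerm (σ : Equiv.Perm (Fin n)) : Equiv.Perm (Slot n) :=
  Equiv.prodCongr (Equiv.refl _) (Equiv.prodCongr σ.finsetCongr σ.finsetCongr)

/-- Port helper `slotPerm_apply` (statement and proof verbatim from the crux workfile; see the file header). -/
theorem slotPerm_apply (σ : Equiv.Perm (Fin n)) (s : Slot n) :
    slotPerm σ s = (s.1, (s.2.1.map σ.toEmbedding, s.2.2.map σ.toEmbedding)) := by
  obtain ⟨k, S, T⟩ := s
  simp [slotPerm]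

/-- conjunctions are equivariant: `cj (σS) (σT) (σa) = cj S T a` -/
theorem cj_map (σ : Equiv.Perm (Fin n)) (S T a : Finset (Fin n)) :
    cj (S.map σ.toEmbedding) (T.map σ.toEmbedding) (a.map σ.toEmbedding) = cj S T a := by
  unfold cj
  by_cases h : S ⊆ a ∧ Disjoint T a
  · rw [if_pos h, if_pos]
    exact ⟨Finset.map_subset_map.mpr h.1, (Finset.disjoint_map _).mpr h.2⟩
  · rw [if_neg h, if_neg]
    exact fun h' => h ⟨Finset.map_subset_map.mp h'.1, (Finset.disjoint_map _).mp h'.2⟩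

/-- the explicit row functions of T1: `U a (k, S, T′) = [|a| = k]·[|S|+|T′| ≤ 2T]·cj S T′ a` -/
def rowSlot (T : ℕ) (a : Finset (Fin n)) (s : Slot n) : ℝ :=
  if a.card = (s.1 : ℕ) ∧ s.2.1.card + s.2.2.card ≤ 2 * T then cj s.2.1 s.2.2 a else 0

/-- Port helper `rowSlot_nonneg` (statement and proof verbatim from the crux workfile; see the file header). -/
theorem rowSlot_nonneg (T : ℕ) (a : Finset (Fin n)) (s : Slot n) : 0 ≤ rowSlot T a s := by
  unfold rowSlot
  split_ifs
  · exact cj_nonneg _ _ _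
  · exact le_rfl

/-- Port helper `rowSlot_eq_zero` (statement and proof verbatim from the crux workfile; see the file header). -/
theorem rowSlot_eq_zero (T : ℕ) (a : Finset (Fin n)) (s : Slot n) (h : ¬ s.2.1.card + s.2.2.card ≤ 2 * T) :
    rowSlot T a s = 0 := by
  unfold rowSlot
  rw [if_neg (fun h' => h h'.2)]

/-- Port helper `rowSlot_map` (statement and proof verbatim from the crux workfile; see the file header). -/
theorem rowSlot_map (T : ℕ) (σ : Equiv.Perm (Fin n)) (a : Finset (Fin n)) (s : Slot n) :
    rowSlot T (a.map σ.toEmbedding) (slotPerm σ s) = rowSlot T a s := by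
  rw [slotPerm_apply]
  unfold rowSlot
  simp only [Finset.card_map, cj_map]

/-- `S_n` acts on the live slots (the degree `|S|+|T′|` is preserved) -/
def liveSlotPerm (T : ℕ) (σ : Equiv.Perm (Fin n)) : Equiv.Perm (LiveSlot n T) :=
  (slotPerm σ).subtypeEquiv (fun s => by rw [slotPerm_apply]; simp only [Finset.card_map])

/-- the row identity of T1 for the explicit row functions (all slots) -/
theorem rowSlot_factor (lam : ℝ) (hlam : 0 < lam) (T : ℕ) (hT : 2 ≤ lam * T) :
    ∃ V : Finset (Fin n) × Equiv.Perm (Fin n) → Slot n → ℝ, (∀ bπ s, 0 ≤ V bπ s) ∧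
      ∀ (a b : Finset (Fin n)) (π : Equiv.Perm (Fin n)),
        ((1 : ℝ) - ((a ∩ b).card : ℝ)) ^ 2 + lam * (inv a π : ℝ) = ∑ s, rowSlot T a s * V (b, π) s := by
  classical
  choose cf h0 hd he using
    fun (π : Equiv.Perm (Fin n)) (k : ℕ) (b : Finset (Fin n)) => col_cert (lam := lam) π k b hlam hT
  refine ⟨fun bπ s => cf bπ.2 (s.1 : ℕ) bπ.1 s.2, fun bπ s => h0 _ _ _ _, ?_⟩
  intro a b π
  have hkn : a.card < n + 1 := by
    have : a.card ≤ n := by simpa using Finset.card_le_univ a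
    omega
  unfold rowSlot
  rw [Fintype.sum_prod_type, Finset.sum_eq_single (⟨a.card, hkn⟩ : Fin (n + 1))]
  · rw [he π a.card b a rfl]
    refine Finset.sum_congr rfl fun p _ => ?_
    dsimp only
    by_cases hp : p.1.card + p.2.card ≤ 2 * T
    · simp only [hp, and_true, if_true]
      ring
    · have hz := hd π a.card b p (by omega)
      simp [hp, hz]
  · intro k _ hk
    have hne : a.card ≠ (k : ℕ) := fun e => hk (Fin.ext e.symm)
    simp [hne]
  · intro h
    exact absurd (Finset.mem_univ _) h

/-- ★ **THEOREM T4, upper half (kernel): the polynomial certificate of T1 is ROW-SYMMETRIC.**  For `λT ≥ 2` there is a row-symmetric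
nonnegative factorisation of `M_λ^{(n)}` through the live slots (`≤ (n+1)^{4T+1}` of them, `card_liveSlot_le`). -/
theorem pencil_symm_upper (n : ℕ) (lam : ℝ) (hlam : 0 < lam) (T : ℕ) (hT : 2 ≤ lam * T) :
    ∃ (U : Finset (Fin n) → LiveSlot n T → ℝ) (V : Finset (Fin n) × Equiv.Perm (Fin n) → LiveSlot n T → ℝ),
      (∀ a s, 0 ≤ U a s) ∧ (∀ bπ s, 0 ≤ V bπ s) ∧ RowSymmetric U ∧
      ∀ a bπ, pencil n lam a bπ = ∑ s, U a s * V bπ s := by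
  classical
  obtain ⟨V, hV, hM⟩ := rowSlot_factor (n := n) lam hlam T hT
  refine ⟨fun a s => rowSlot T a s.1, fun bπ s => V bπ s.1, fun a s => rowSlot_nonneg T a s.1, fun bπ s => hV _ _,
    fun σ => ⟨liveSlotPerm T σ, fun a s => rowSlot_map T σ a s.1⟩, ?_⟩
  rintro a ⟨b, π⟩
  show pencil n lam a (b, π) = ∑ s : LiveSlot n T, rowSlot T a s.1 * V (b, π) s.1
  unfold pencil
  rw [hM a b π, ← Finset.sum_filter_of_ne (p := fun s : Slot n => s.2.1.card + s.2.2.card ≤ 2 * T)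
    (fun s _ hs => by
      by_contra hc
      exact left_ne_zero_of_mul hs (rowSlot_eq_zero T a s hc))]
  exact Finset.sum_subtype _ (fun s => by simp) _

/-! ### T4, lower half: a row-symmetric certificate with fewer than `C(n, D+1)` slots forces `λ ≥ 1/(4D)` -/

/-- the Boolean-cube rendering of a row, `x_a(j) = [j ∈ a]`, and back -/
def toCube (a : Finset (Fin n)) : Fin n → Bool := fun j => decide (j ∈ a)

/-- … and back -/
def ofCube (x : Fin n → Bool) : Finset (Fin n) := Finset.univ.filter (fun j => x j = true)

/-- Port helper `ofCube_toCube` (statement and proof verbatim from the crux workfile; see the file header). -/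
theorem ofCube_toCube (a : Finset (Fin n)) : ofCube (toCube a) = a := by
  ext j; simp [ofCube, toCube]

/-- Port helper `ofCube_comp_symm` (statement and proof verbatim from the crux workfile; see the file header). -/
theorem ofCube_comp_symm (x : Fin n → Bool) (σ : Equiv.Perm (Fin n)) :
    ofCube (x ∘ ⇑σ.symm) = (ofCube x).map σ.toEmbedding := by
  ext j; simp [ofCube, Finset.mem_map_equiv]

/-- Port helper `card_filter_toCube` (statement and proof verbatim from the crux workfile; see the file header). -/
theorem card_filter_toCube (a : Finset (Fin n)) :
    (Finset.univ.filter fun j => toCube a j = true).card = a.card := by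
  congr 1; ext j; simp [toCube]

/-- **CLRS Lemma 4.2 for row-symmetric slot families** (the tree's PROVED `ChanEtAl2016_lemma42` = Yannakakis / Dixon–Mortimer 5.2B, transported
from the cube `{0,1}ⁿ` to `Finset (Fin n)`): fewer than `C(n,d)` row-symmetric slots (`n > 8`, `1 ≤ d`, `4d ≤ n`) ⇒ every row function `U_s`
depends only on `a ∩ X_s` and `|a|`, for some `|X_s| < d`. -/
theorem rowSymmetric_junta {d : ℕ} (hn : 8 < n) (hd : 1 ≤ d) (h4d : 4 * d ≤ n) {S : Type*} [Fintype S]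
    (U : Finset (Fin n) → S → ℝ) (hsym : RowSymmetric U) (hS : Fintype.card S < n.choose d) (s : S) :
    ∃ X : Finset (Fin n), X.card < d ∧
      ∀ a a' : Finset (Fin n), a ∩ X = a' ∩ X → a.card = a'.card → U a s = U a' s := by
  classical
  set R := Fintype.card S with hR
  let e : S ≃ Fin R := Fintype.equivFin S
  let q : Fin R → (Fin n → Bool) → ℝ := fun i x => U (ofCube x) (e.symm i)
  have hclosed : ∀ σ : Equiv.Perm (Fin n), ∃ π : Equiv.Perm (Fin R), ∀ (i : Fin R) (x : Fin n → Bool),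
      q (π i) (x ∘ ⇑σ.symm) = q i x := by
    intro σ
    obtain ⟨τ, hτ⟩ := hsym σ
    refine ⟨(e.symm.trans τ).trans e, fun i x => ?_⟩
    show U (ofCube (x ∘ ⇑σ.symm)) (e.symm (e (τ (e.symm i)))) = U (ofCube x) (e.symm i)
    rw [e.symm_apply_apply, ofCube_comp_symm, hτ]
  obtain ⟨X, hXd, hX⟩ :=
    Literature.Combinatorics.Optimization.ChanEtAl2016_lemma42 hclosed hn hd h4d (hR ▸ hS) (e s)
  refine ⟨X, hXd, fun a a' hX' hcard => ?_⟩
  have hag : ∀ j ∈ X, toCube a j = toCube a' j := by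
    intro j hj
    have hiff : j ∈ a ↔ j ∈ a' := by
      constructor
      · intro hja
        have h2 : j ∈ a' ∩ X := hX' ▸ Finset.mem_inter.mpr ⟨hja, hj⟩
        exact (Finset.mem_inter.mp h2).1
      · intro hja
        have h2 : j ∈ a ∩ X := hX'.symm ▸ Finset.mem_inter.mpr ⟨hja, hj⟩
        exact (Finset.mem_inter.mp h2).1
    simp [toCube, hiff]
  have h := Literature.Combinatorics.Optimization.eq_of_agree_of_card_eq (hX) hag
    (by rw [card_filter_toCube, card_filter_toCube, hcard])
  simpa [q, ofCube_toCube] using h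

/-- on any row, the degree-`|X|` atom `cj W (X ∖ W)` (`W ⊆ X`) is the indicator `[a ∩ X = W]` -/
theorem cj_inter_eq (X W a : Finset (Fin n)) (hW : W ⊆ X) : cj W (X \ W) a = if a ∩ X = W then 1 else 0 := by
  unfold cj
  by_cases h : a ∩ X = W
  · rw [if_pos h, if_pos]
    refine ⟨?_, ?_⟩
    · rw [← h]; exact Finset.inter_subset_left
    · rw [← h]
      exact Finset.disjoint_left.mpr (fun j hj hja =>
        (Finset.mem_sdiff.mp hj).2 (Finset.mem_inter.mpr ⟨hja, (Finset.mem_sdiff.mp hj).1⟩))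
  · rw [if_neg h, if_neg]
    rintro ⟨hWa, hdisj⟩
    apply h
    ext j
    simp only [Finset.mem_inter]
    constructor
    · rintro ⟨hja, hjX⟩
      by_contra hjW
      exact Finset.disjoint_left.mp hdisj (Finset.mem_sdiff.mpr ⟨hjX, hjW⟩) hja
    · intro hjW
      exact ⟨hWa hjW, hW hjW⟩

/-- ★★★ **THEOREM T4 (kernel), lower half: ROW-SYMMETRIC certificates need `C(n, D+1)` slots below `λ = 1/(4D)`.**  If `n > 8`,
`1 ≤ D`, `4(D+1) ≤ n`, `0 ≤ λ < 1/(4D)` and `M_λ^{(n)} = Σ_s U_s ⊗ V_s` is a nonnegative factorisation whose row factor is row-symmetric, then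
`|S| ≥ C(n, D+1)`.  Reading (with T1/`pencil_symm_upper`): the least number of slots of a ROW-SYMMETRIC nonnegative factorisation of `M_λ^{(n)}` is
`n^{Θ(min(n, 1/λ))}` — superpolynomial iff `λ → 0`; the S2 window is closed for symmetric certificates. -/
theorem pencil_symm_lower {D : ℕ} (hn : 8 < n) (hD : 1 ≤ D) (h4D : 4 * (D + 1) ≤ n) (lam : ℝ) (hlam : 0 ≤ lam)
    (hsmall : lam < 1 / (4 * (D : ℝ))) {S : Type*} [Fintype S]
    (U : Finset (Fin n) → S → ℝ) (V : Finset (Fin n) × Equiv.Perm (Fin n) → S → ℝ)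
    (hU : ∀ a s, 0 ≤ U a s) (hV : ∀ bπ s, 0 ≤ V bπ s) (hsym : RowSymmetric U)
    (hfac : ∀ a bπ, pencil n lam a bπ = ∑ s, U a s * V bπ s) :
    n.choose (D + 1) ≤ Fintype.card S := by
  classical
  by_contra hlt
  push Not at hlt
  -- junta structure of every row function (CLRS Lemma 4.2)
  choose X hXd hXU using fun s => rowSymmetric_junta hn (by omega) h4D U hsym hlt s
  have hkn : 2 * D + 2 * D ≤ n := by omega
  -- the column of T2: cut `k = 2D`, the `2D` outsider positions nearest the cut, `π = 1`
  obtain ⟨coef, hcoef⟩ : ∃ coef : S → Finset (Fin n) → ℝ, ∀ s W, coef s W =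
      if h : ∃ a' : Finset (Fin n), a'.card = 2 * D ∧ a' ∩ X s = W then U h.choose s else 0 := ⟨_, fun _ _ => rfl⟩
  have hcoef0 : ∀ s W, 0 ≤ coef s W := by
    intro s W
    rw [hcoef]
    split_ifs
    · exact hU _ _
    · exact le_rfl
  obtain ⟨g, hg_def⟩ : ∃ g : Finset (Fin n) → ℝ, ∀ a, g a =
      ∑ s, V (cutCol (1 : Equiv.Perm (Fin n)) (2 * D) (2 * D), 1) s *
        ∑ W ∈ (X s).powerset, coef s W * cj W (X s \ W) a := ⟨_, fun _ => rfl⟩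
  have hg : InCone D g := by
    refine (InCone.sum Finset.univ
      (fun s a => V (cutCol (1 : Equiv.Perm (Fin n)) (2 * D) (2 * D), 1) s *
        ∑ W ∈ (X s).powerset, coef s W * cj W (X s \ W) a)
      (fun s _ => InCone.smul (hV _ _) (InCone.sum (X s).powerset (fun W a => coef s W * cj W (X s \ W) a)
        (fun W hW => InCone.atom (hcoef0 s W) ?_)))).congr (fun a => (hg_def a).symm)
    have hWX : W ⊆ X s := Finset.mem_powerset.mp hW
    have h1 : W.card + (X s \ W).card = (X s).card := by
      rw [add_comm]; exact Finset.card_sdiff_add_card_eq_card hWX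
    have h2 := hXd s
    omega
  have hslice : ∀ a : Finset (Fin n), a.card = 2 * D →
      ((1 : ℝ) - ((a ∩ cutCol (1 : Equiv.Perm (Fin n)) (2 * D) (2 * D)).card : ℝ)) ^ 2 + lam * (inv a 1 : ℝ) = g a := by
    intro a ha
    have h1 := hfac a (cutCol (1 : Equiv.Perm (Fin n)) (2 * D) (2 * D), 1)
    simp only [pencil] at h1
    rw [h1, hg_def]
    refine Finset.sum_congr rfl (fun s _ => ?_)
    rw [Finset.sum_eq_single (a ∩ X s)]
    · have hex : ∃ a' : Finset (Fin n), a'.card = 2 * D ∧ a' ∩ X s = a ∩ X s := ⟨a, ha, rfl⟩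
      have hc : coef s (a ∩ X s) = U a s := by
        rw [hcoef, dif_pos hex]
        exact hXU s _ _ hex.choose_spec.2 (hex.choose_spec.1.trans ha.symm)
      rw [cj_inter_eq _ _ _ Finset.inter_subset_right, if_pos rfl, hc]
      ring
    · intro W hW hne
      rw [cj_inter_eq _ _ _ (Finset.mem_powerset.mp hW), if_neg (fun h => hne h.symm)]
      ring
    · intro h
      exact absurd (Finset.mem_powerset.mpr Finset.inter_subset_right) h
  have hq := slice_cone_lower_quarter (1 : Equiv.Perm (Fin n)) (2 * D) D lam hlam hD le_rfl hkn ⟨g, hg, hslice⟩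
  linarith

/-- COROLLARY (the symmetric nonnegative rank in the tree's currency): a row-symmetric factorisation of `M_λ^{(n)}` of size `r` with
`r < C(n, D+1)`, `n > 8`, `4(D+1) ≤ n` forces `λ ≥ 1/(4D)`. -/
theorem pencil_symm_lower' {D : ℕ} (hn : 8 < n) (hD : 1 ≤ D) (h4D : 4 * (D + 1) ≤ n) (lam : ℝ) (hlam : 0 ≤ lam)
    {S : Type*} [Fintype S]
    (U : Finset (Fin n) → S → ℝ) (V : Finset (Fin n) × Equiv.Perm (Fin n) → S → ℝ)
    (hU : ∀ a s, 0 ≤ U a s) (hV : ∀ bπ s, 0 ≤ V bπ s) (hsym : RowSymmetric U)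
    (hfac : ∀ a bπ, pencil n lam a bπ = ∑ s, U a s * V bπ s) (hS : Fintype.card S < n.choose (D + 1)) :
    1 / (4 * (D : ℝ)) ≤ lam := by
  by_contra h
  push Not at h
  exact absurd (pencil_symm_lower hn hD h4D lam hlam h U V hU hV hsym hfac) (not_le.mpr hS)

end Symmetric

end

end Summit.ValiantsHypothesis.Theorems.NNDivisionHardNegative.RealLambda
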